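import Summits.SmoothPoincare4.SmoothPoincare4.Theorems.ConvexBisectionAcyclicBisectionExistsHgapTwistChart3
import Summits.SmoothPoincare4.SmoothPoincare4.Theorems.ConvexBisectionAcyclicBisectionExistsHgapTwistGlue
import Summits.SmoothPoincare4.SmoothPoincare4.Theorems.ConvexBisectionAcyclicBisectionExistsSeamTwistSignBoundaryDeriv
import HarnessLib

/-!
# Hgap ▸ part B (page twisting of the straightened dual framed knot), brick H1-c (sphere ↔ tube side):
# the glued factorisation `Γ̂ = (R₁ ∘ seamB) ∘ η̂` of the belt-tube chart and the sign relation
# `sign χ = twistSign · sign χ_η`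
(wave 7, crux stmt-SmoothPoincare4-10508, line `modp-braid-orbits`, stub `stub_T3_dualPresentation` (T3)
▸ node `Hgap` ▸ part B `helper_Hgap_twisting` ▸ (R6b); registered sub-goal `helper_beltChar_glued`)

Over the GLUED region `0 < ‖m‖ < 1` the belt tube `β♭ = (beltMap D j).boundaryTube` of the `j`-th handle
is the attaching tube `f♭ = (h j).boundaryTube` with core angle and fibre direction EXCHANGED
(`coe_belt_boundaryTube_polar`, `…HgapTwistGlue.lean`).  Hence the three-dimensional belt-tube chart
`Γ̂ (p) = (R₁ (seam (β♭ (circlePt (p 2), L p)))).1` of `…HgapTwistChart3.lean` factors, near every `p` with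
`L p ≠ 0`, as `Γ̂ = (val ∘ R₁ ∘ seamB D bX Ψ) ∘ η̂` through the TUBE-SIDE MAP

  `η̂ (p) = f♭ (circlePt (arg (toC (L p)) / 2π), ‖L p‖ • circlePt (p 2)) ∈ ∂ Base g`

(`circlePt (arg (toC m) / 2π) = m / ‖m‖`; `seamB` is X3's seam map on `∂ Base g`).  This file proves:

* §1 the direction identity and the EXCHANGE at the level of points (`seam_belt_exchange`,
  `beltChart₃_eq_seamB_tubeMap`);
* §2 `η̂` is smooth where `toC (L p)` is in the slit plane (`contMDiffAt_tubeMap`);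
* §3 the column factorisation `dΓ̂ u = bdDeriv (R₁ ∘ seamB) (η̂ p) (dη♯ u)`, `η♯ = val ∘ val ∘ η̂ : ℝ³ → ℝ⁴`
  (`mfderiv_beltChart₃_glued`), and the non-vanishing of the tube-side character
  `χ_η (p) = det4 (∇rho (η♯ p), dη♯ e₀, dη♯ e₁, dη♯ e₂)`;
* §4 **the sign relation** (`beltChar_glued_sign`, registered `helper_beltChar_glued`): for a
  `rho`-preserving ambient isotopy `R`, at a glued flat point, `0 < twistSign (η̂ p) · χ (p) · χ_η (p)` —
  G3's `helper_twistSign_det4_flatten` applied to the frame `dη♯ e` (or its transposition).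

With H2's tube-side computation `sign χ_η = -ε` and `…HgapCharRadial/Belt.lean` this gives the transfer
`σ̂ = -s₀ ε` of `G2-REPORT.md` §4 (R6).  Everything is proved; no named facts, no `sorry`.  References:
A. A. Kosinski, *Differential Manifolds* (1993), VI §6 [Kosinski1993]; R. İ. Baykur, AGT 6 (2006), §2.3 [Baykur2006].
-/

noncomputable section

set_option linter.dupNamespace false

open scoped Manifold ContDiff Topology RealInnerProductSpace
open Set Function Metric Filter Complex
open Literature.Topology.FourManifolds Literature.Topology.FourManifolds.HandleAttachingMap
  Literature.Topology.FourManifolds.LefschetzBase Literature.Geometry.Symplectic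

namespace Summit.SmoothPoincare4.SmoothPoincare4.Theorems.AcyclicBisectionExists.ModpBraidOrbits

/-! ## §1 The direction of a plane vector and the exchange identity -/

/-- **The direction of a plane vector**: `‖m‖ • circlePt (arg (toC m) / 2π) = m` (also for `m = 0`). [folklore] -/
theorem norm_smul_circlePt_arg (m : EuclideanSpace ℝ (Fin 2)) :
    ‖m‖ • ((circlePt (Complex.arg (toC m) / (2 * Real.pi)) : sphere (0 : EuclideanSpace ℝ (Fin 2)) 1) :
      EuclideanSpace ℝ (Fin 2)) = m := by
  apply toC_injective
  have hsm : ∀ (r : ℝ) (v : EuclideanSpace ℝ (Fin 2)), toC (r • v) = (r : ℂ) * toC v := fun r v => by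
    apply Complex.ext <;> simp [toC]
  rw [hsm, toC_circlePt, Circle.coe_exp]
  have hπ : (2 : ℝ) * Real.pi ≠ 0 := by positivity
  have e : 2 * Real.pi * (Complex.arg (toC m) / (2 * Real.pi)) = Complex.arg (toC m) := by
    field_simp
  rw [e, ← norm_toC m]
  exact Complex.norm_mul_exp_arg_mul_I (toC m)

/-- A vector with `toC` in the slit plane is non-zero. [folklore] -/
theorem ne_zero_of_toC_mem_slitPlane {m : EuclideanSpace ℝ (Fin 2)} (hm : toC m ∈ Complex.slitPlane) :
    m ≠ 0 := by
  rintro rfl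
  have : toC (0 : EuclideanSpace ℝ (Fin 2)) = 0 := by apply Complex.ext <;> simp [toC]
  exact Complex.slitPlane_ne_zero hm this

section Exchange

variable {g : ℕ} {ι : Type} [Finite ι] {h : ι → HandleAttachingMap 3 2 (Base g)}
  {X : Type} [TopologicalSpace X] [ChartedSpace (EuclideanHalfSpace 4) X] [IsManifold (𝓡∂ 4) ∞ X]
  (D : MultiAttachmentData h (𝓡∂ 4) X) (bX : BoundaryData (𝓡∂ 4) X (𝓡 3)) [Nonempty bX.carrier]
  (Ψ : bX.carrier ≃ₘ⟮𝓡 3, 𝓡 3⟯ (bBase g).carrier)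

include D in
omit [IsManifold (𝓡∂ 4) ∞ X] [Nonempty bX.carrier] in
/-- The attaching-tube point with exchanged coordinates is off the cores. [folklore] -/
theorem tubePt_mem_coresComplement (j : ι) (u θ : sphere (0 : EuclideanSpace ℝ (Fin 2)) 1) {r : ℝ}
    (hr0 : 0 < r) (hr1 : r < 1) :
    (((h j).boundaryTube.toHomeo (u, r • (θ : EuclideanSpace ℝ (Fin 2)))).1 : Base g) ∈ coresComplement h :=
  BeltPageClause.apply_mem_coresComplement_of_lamSq_ne_one D.disjoint j _
    (lamSq_depthLine_radial_ne_one u θ hr0 hr1)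

/-- **The exchange identity at the level of points**: the seam push of the belt tube point
`β♭ (θ, r u)` (`0 < r < 1`) is X3's seam map `seamB` at the attaching tube point `f♭ (u, r θ)`.
[cite: Kosinski1993, VI §6] -/
theorem seam_belt_exchange (j : ι) (u θ : sphere (0 : EuclideanSpace ℝ (Fin 2)) 1) {r : ℝ}
    (hr0 : 0 < r) (hr1 : r < 1) :
    (BoundaryManifold.boundaryData 3 (Base g)).incl (seamDiffeo bX (bBase g) Ψ
        ((beltMap D j).boundaryTube.toHomeo (θ, r • (u : EuclideanSpace ℝ (Fin 2))))) =
      seamB D bX Ψ ((h j).boundaryTube.toHomeo (u, r • (θ : EuclideanSpace ℝ (Fin 2)))) := by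
  set y := (beltMap D j).boundaryTube.toHomeo (θ, r • (u : EuclideanSpace ℝ (Fin 2))) with hy
  set z := (BoundaryManifold.boundaryData 3 X).restrictDiffeomorph bX (Diffeomorph.refl (𝓡∂ 4) X ∞) y
    with hz
  set y' : (bBase g).carrier := (h j).boundaryTube.toHomeo (u, r • (θ : EuclideanSpace ℝ (Fin 2))) with hy'
  have hcc : ((y'.1 : Base g)) ∈ coresComplement h := tubePt_mem_coresComplement D j u θ hr0 hr1
  have hz' : bX.incl z = D.jA ⟨y'.1, hcc⟩ := by
    rw [hz, incl_restrict_refl, BoundaryManifold.boundaryData_incl]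
    exact coe_belt_boundaryTube_polar D j u θ hr0 hr1
  have hlift : bX.incl (seamLift D bX Ψ y') = D.jA ⟨y'.1, hcc⟩ := incl_seamLift D bX Ψ hcc
  have hzl : z = seamLift D bX Ψ y' := bX.injective_incl (hz'.trans hlift.symm)
  rw [coe_seamDiffeo, seamB_eq, ← hzl]

end Exchange

/-! ## §2 The tube-side map `η̂` and its smoothness -/

section TubeMap

variable {g : ℕ} {ι : Type} {h : ι → HandleAttachingMap 3 2 (Base g)} (j : ι)
  {L : EuclideanSpace ℝ (Fin 3) →L[ℝ] EuclideanSpace ℝ (Fin 2)}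

/-- **The tube-side map is smooth where the angle is**: at `p` with `toC (L p)` in the slit plane and
`‖L p‖ < 1`, `η̂ (p) = f♭ (circlePt (arg (toC (L p)) / 2π), ‖L p‖ • circlePt (p 2))` is `C^∞`.
[cite: Kosinski1993, VI §6] -/
theorem contMDiffAt_tubeMap (p : EuclideanSpace ℝ (Fin 3)) (hslit : toC (L p) ∈ Complex.slitPlane)
    (hp : ‖L p‖ < 1) :
    ContMDiffAt 𝓘(ℝ, EuclideanSpace ℝ (Fin 3)) (𝓡 3) ∞ (fun p : EuclideanSpace ℝ (Fin 3) =>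
      (h j).boundaryTube.toHomeo (circlePt (Complex.arg (toC (L p)) / (2 * Real.pi)),
        ‖L p‖ • ((circlePt (p 2) : sphere (0 : EuclideanSpace ℝ (Fin 2)) 1) : EuclideanSpace ℝ (Fin 2)))) p := by
  have h0 : L p ≠ 0 := ne_zero_of_toC_mem_slitPlane hslit
  -- the angle `ψ (p) = arg (toC (L p)) / 2π` is smooth at `p`
  have hψ : ContDiffAt ℝ ∞ (fun p : EuclideanSpace ℝ (Fin 3) => Complex.arg (toC (L p)) / (2 * Real.pi)) p :=
    (((contDiffAt_arg hslit).comp p (contDiff_toC.contDiffAt.comp p L.contDiff.contDiffAt))).div_const _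
  have h1 : ContMDiffAt 𝓘(ℝ, EuclideanSpace ℝ (Fin 3)) (𝓡 1) ∞
      (fun p : EuclideanSpace ℝ (Fin 3) => circlePt (Complex.arg (toC (L p)) / (2 * Real.pi))) p :=
    contMDiff_circlePt.contMDiffAt.comp p hψ.contMDiffAt
  -- the fibre vector `‖L p‖ • circlePt (p 2)` is smooth at `p`
  have hcirc : ContDiff ℝ ∞ (fun t : ℝ => ((circlePt t : sphere (0 : EuclideanSpace ℝ (Fin 2)) 1) :
      EuclideanSpace ℝ (Fin 2))) :=
    contDiff_coe_circlePoint.comp (contDiff_const.mul contDiff_id)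
  have h2 : ContDiffAt ℝ ∞ (fun p : EuclideanSpace ℝ (Fin 3) =>
      ‖L p‖ • ((circlePt (p 2) : sphere (0 : EuclideanSpace ℝ (Fin 2)) 1) : EuclideanSpace ℝ (Fin 2))) p :=
    ((contDiffAt_norm ℝ h0).comp p L.contDiff.contDiffAt).smul
      (hcirc.contDiffAt.comp p (EuclideanSpace.proj (𝕜 := ℝ) (2 : Fin 3)).contDiff.contDiffAt)
  have h12 : ContMDiffAt 𝓘(ℝ, EuclideanSpace ℝ (Fin 3)) ((𝓡 1).prod 𝓘(ℝ, EuclideanSpace ℝ (Fin 2))) ∞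
      (fun p : EuclideanSpace ℝ (Fin 3) => ((circlePt (Complex.arg (toC (L p)) / (2 * Real.pi)),
        ‖L p‖ • ((circlePt (p 2) : sphere (0 : EuclideanSpace ℝ (Fin 2)) 1) : EuclideanSpace ℝ (Fin 2))) :
          (sphere (0 : EuclideanSpace ℝ (Fin 2)) 1) × EuclideanSpace ℝ (Fin 2))) p :=
    h1.prodMk h2.contMDiffAt
  have hsrc : ((circlePt (Complex.arg (toC (L p)) / (2 * Real.pi)),
      ‖L p‖ • ((circlePt (p 2) : sphere (0 : EuclideanSpace ℝ (Fin 2)) 1) : EuclideanSpace ℝ (Fin 2))) :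
        (sphere (0 : EuclideanSpace ℝ (Fin 2)) 1) × EuclideanSpace ℝ (Fin 2)) ∈ (h j).boundaryTube.toHomeo.source := by
    rw [CircleTube.mem_source_iff, norm_smul, norm_norm, norm_eq_of_mem_sphere, mul_one]
    exact hp
  exact ((h j).boundaryTube.contMDiffAt_toHomeo hsrc).comp p h12

/-- The tube-side map takes boundary values: `rho (η♯ p) = 1/4`. [folklore] -/
theorem rho_tubeChart (p : EuclideanSpace ℝ (Fin 3)) :
    rho g ((((h j).boundaryTube.toHomeo (circlePt (Complex.arg (toC (L p)) / (2 * Real.pi)),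
      ‖L p‖ • ((circlePt (p 2) : sphere (0 : EuclideanSpace ℝ (Fin 2)) 1) : EuclideanSpace ℝ (Fin 2)))).1).1) = 1 / 4 :=
  (RegularSublevel.mem_boundary_iff (isRegularLevel_rho g) _).1 ((h j).boundaryTube.toHomeo _).2

/-- **The differential of `η♯ = val ∘ val ∘ η̂`** is the ambient image of `dη̂`:
`dη♯ u = ambient (η̂ p) (0, dη̂ u)`. [folklore] -/
theorem mfderiv_tubeChart (p : EuclideanSpace ℝ (Fin 3)) (hslit : toC (L p) ∈ Complex.slitPlane)
    (hp : ‖L p‖ < 1) (u : EuclideanSpace ℝ (Fin 3)) :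
    mfderiv 𝓘(ℝ, EuclideanSpace ℝ (Fin 3)) 𝓘(ℝ, EuclideanSpace ℝ (Fin 4)) (fun p : EuclideanSpace ℝ (Fin 3) =>
      ((((h j).boundaryTube.toHomeo (circlePt (Complex.arg (toC (L p)) / (2 * Real.pi)),
        ‖L p‖ • ((circlePt (p 2) : sphere (0 : EuclideanSpace ℝ (Fin 2)) 1) : EuclideanSpace ℝ (Fin 2)))).1).1 :
          EuclideanSpace ℝ (Fin 4))) p u =
      ambient g (((h j).boundaryTube.toHomeo (circlePt (Complex.arg (toC (L p)) / (2 * Real.pi)),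
        ‖L p‖ • ((circlePt (p 2) : sphere (0 : EuclideanSpace ℝ (Fin 2)) 1) : EuclideanSpace ℝ (Fin 2)))).1)
        (consZeroL 3 (mfderiv 𝓘(ℝ, EuclideanSpace ℝ (Fin 3)) (𝓡 3) (fun p : EuclideanSpace ℝ (Fin 3) =>
          (h j).boundaryTube.toHomeo (circlePt (Complex.arg (toC (L p)) / (2 * Real.pi)),
            ‖L p‖ • ((circlePt (p 2) : sphere (0 : EuclideanSpace ℝ (Fin 2)) 1) : EuclideanSpace ℝ (Fin 2)))) p u)) := by
  have hη := ((contMDiffAt_tubeMap (h := h) j p hslit hp).mdifferentiableAt (by simp)).hasMFDerivAt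
  have hvv := hasMFDerivAt_val_val (g := g) ((h j).boundaryTube.toHomeo
    (circlePt (Complex.arg (toC (L p)) / (2 * Real.pi)),
      ‖L p‖ • ((circlePt (p 2) : sphere (0 : EuclideanSpace ℝ (Fin 2)) 1) : EuclideanSpace ℝ (Fin 2))))
  have hc : HasMFDerivAt 𝓘(ℝ, EuclideanSpace ℝ (Fin 3)) 𝓘(ℝ, EuclideanSpace ℝ (Fin 4))
      (fun p : EuclideanSpace ℝ (Fin 3) =>
        ((((h j).boundaryTube.toHomeo (circlePt (Complex.arg (toC (L p)) / (2 * Real.pi)),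
          ‖L p‖ • ((circlePt (p 2) : sphere (0 : EuclideanSpace ℝ (Fin 2)) 1) : EuclideanSpace ℝ (Fin 2)))).1).1 :
            EuclideanSpace ℝ (Fin 4))) p (((ambientCLM g ((h j).boundaryTube.toHomeo
              (circlePt (Complex.arg (toC (L p)) / (2 * Real.pi)),
                ‖L p‖ • ((circlePt (p 2) : sphere (0 : EuclideanSpace ℝ (Fin 2)) 1) : EuclideanSpace ℝ (Fin 2)))).1).comp
          (consZeroL 3)).comp (mfderiv 𝓘(ℝ, EuclideanSpace ℝ (Fin 3)) (𝓡 3) (fun p : EuclideanSpace ℝ (Fin 3) =>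
            (h j).boundaryTube.toHomeo (circlePt (Complex.arg (toC (L p)) / (2 * Real.pi)),
              ‖L p‖ • ((circlePt (p 2) : sphere (0 : EuclideanSpace ℝ (Fin 2)) 1) : EuclideanSpace ℝ (Fin 2)))) p)) := by
    have hc0 := hvv.comp p hη
    exact hc0
  rw [hc.mfderiv]
  rfl

/-- The columns of `η♯` are tangent to the boundary: `d rho (dη♯ u) = 0`. [folklore] -/
theorem fderiv_rho_tubeChart (p : EuclideanSpace ℝ (Fin 3)) (hslit : toC (L p) ∈ Complex.slitPlane)
    (hp : ‖L p‖ < 1) (u : EuclideanSpace ℝ (Fin 3)) :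
    fderiv ℝ (rho g) ((((h j).boundaryTube.toHomeo (circlePt (Complex.arg (toC (L p)) / (2 * Real.pi)),
        ‖L p‖ • ((circlePt (p 2) : sphere (0 : EuclideanSpace ℝ (Fin 2)) 1) : EuclideanSpace ℝ (Fin 2)))).1).1)
      (mfderiv 𝓘(ℝ, EuclideanSpace ℝ (Fin 3)) 𝓘(ℝ, EuclideanSpace ℝ (Fin 4)) (fun p : EuclideanSpace ℝ (Fin 3) =>
        ((((h j).boundaryTube.toHomeo (circlePt (Complex.arg (toC (L p)) / (2 * Real.pi)),
          ‖L p‖ • ((circlePt (p 2) : sphere (0 : EuclideanSpace ℝ (Fin 2)) 1) : EuclideanSpace ℝ (Fin 2)))).1).1 :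
            EuclideanSpace ℝ (Fin 4))) p u) = 0 := by
  rw [mfderiv_tubeChart (g := g) j p hslit hp u, fderiv_rho_ambient _ (rho_tubeChart (g := g) j p),
    consZeroL_apply_zero, neg_zero]

end TubeMap

/-! ## §3 The glued factorisation of the belt-tube chart and of its columns -/

section Factor

variable {g : ℕ} {ι : Type} [Finite ι] {h : ι → HandleAttachingMap 3 2 (Base g)}
  {X : Type} [TopologicalSpace X] [ChartedSpace (EuclideanHalfSpace 4) X] [IsManifold (𝓡∂ 4) ∞ X]
  (D : MultiAttachmentData h (𝓡∂ 4) X) (bX : BoundaryData (𝓡∂ 4) X (𝓡 3)) [Nonempty bX.carrier]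
  (Ψ : bX.carrier ≃ₘ⟮𝓡 3, 𝓡 3⟯ (bBase g).carrier) (E : Base g → Base g) (j : ι)
  {L : EuclideanSpace ℝ (Fin 3) →L[ℝ] EuclideanSpace ℝ (Fin 2)}

/-- **The glued factorisation at the level of points**: for `L p ≠ 0`, `‖L p‖ < 1` and ANY map `E` of the
base, `Γ̂ (p) = (E (seamB (η̂ p))).1`. [cite: Kosinski1993, VI §6] -/
theorem beltChart₃_eq_seamB_tubeMap (p : EuclideanSpace ℝ (Fin 3)) (h0 : L p ≠ 0) (hp : ‖L p‖ < 1) :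
    (E ((BoundaryManifold.boundaryData 3 (Base g)).incl (seamDiffeo bX (bBase g) Ψ
        ((beltMap D j).boundaryTube.toHomeo (circlePt (p 2), L p))))).1 =
      (E (seamB D bX Ψ ((h j).boundaryTube.toHomeo (circlePt (Complex.arg (toC (L p)) / (2 * Real.pi)),
        ‖L p‖ • ((circlePt (p 2) : sphere (0 : EuclideanSpace ℝ (Fin 2)) 1) : EuclideanSpace ℝ (Fin 2)))))).1 := by
  have hr0 : 0 < ‖L p‖ := norm_pos_iff.2 h0
  have key := seam_belt_exchange D bX Ψ j (circlePt (Complex.arg (toC (L p)) / (2 * Real.pi))) (circlePt (p 2))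
    hr0 hp
  rw [norm_smul_circlePt_arg (L p)] at key
  rw [key]

/-- The glued region `{L p ≠ 0, ‖L p‖ < 1}` is open. [folklore] -/
theorem isOpen_gluedDom (L : EuclideanSpace ℝ (Fin 3) →L[ℝ] EuclideanSpace ℝ (Fin 2)) :
    IsOpen {p : EuclideanSpace ℝ (Fin 3) | L p ≠ 0 ∧ ‖L p‖ < 1} :=
  (isOpen_compl_singleton.preimage L.continuous).inter
    (isOpen_lt (continuous_norm.comp L.continuous) continuous_const)

/-- **The glued factorisation near a glued point**: `Γ̂ = (val ∘ E ∘ seamB) ∘ η̂` on a neighbourhood of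
every `p` with `L p ≠ 0`, `‖L p‖ < 1`. [cite: Kosinski1993, VI §6] -/
theorem beltChart₃_eventuallyEq_glued (p : EuclideanSpace ℝ (Fin 3)) (h0 : L p ≠ 0) (hp : ‖L p‖ < 1) :
    (fun p : EuclideanSpace ℝ (Fin 3) => (E ((BoundaryManifold.boundaryData 3 (Base g)).incl
        (seamDiffeo bX (bBase g) Ψ ((beltMap D j).boundaryTube.toHomeo (circlePt (p 2), L p))))).1) =ᶠ[𝓝 p]
      (fun y : (bBase g).carrier => ((E (seamB D bX Ψ y)).1 : EuclideanSpace ℝ (Fin 4))) ∘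
        (fun p : EuclideanSpace ℝ (Fin 3) => (h j).boundaryTube.toHomeo
          (circlePt (Complex.arg (toC (L p)) / (2 * Real.pi)),
            ‖L p‖ • ((circlePt (p 2) : sphere (0 : EuclideanSpace ℝ (Fin 2)) 1) : EuclideanSpace ℝ (Fin 2)))) := by
  filter_upwards [(isOpen_gluedDom L).mem_nhds ⟨h0, hp⟩] with q hq
  exact beltChart₃_eq_seamB_tubeMap D bX Ψ E j q hq.1 hq.2

/-- **The glued factorisation of the columns** (brick H1-c): for a smooth `E`, at `p` with `toC (L p)` in
the slit plane and `‖L p‖ < 1`, `dΓ̂_p (u) = bdDeriv (E ∘ seamB) (η̂ p) (dη♯_p (u))` for every `u`, with X3's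
boundary ambient differential `bdDeriv`. [cite: Kosinski1993, VI §6] -/
theorem mfderiv_beltChart₃_glued (hE : ContMDiff (𝓡∂ 4) (𝓡∂ 4) ∞ E) (p : EuclideanSpace ℝ (Fin 3))
    (hslit : toC (L p) ∈ Complex.slitPlane) (hp : ‖L p‖ < 1) (u : EuclideanSpace ℝ (Fin 3)) :
    mfderiv 𝓘(ℝ, EuclideanSpace ℝ (Fin 3)) 𝓘(ℝ, EuclideanSpace ℝ (Fin 4))
        (fun p : EuclideanSpace ℝ (Fin 3) => (E ((BoundaryManifold.boundaryData 3 (Base g)).incl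
          (seamDiffeo bX (bBase g) Ψ ((beltMap D j).boundaryTube.toHomeo (circlePt (p 2), L p))))).1) p u =
      bdDeriv g (E ∘ seamB D bX Ψ) ((h j).boundaryTube.toHomeo (circlePt (Complex.arg (toC (L p)) / (2 * Real.pi)),
          ‖L p‖ • ((circlePt (p 2) : sphere (0 : EuclideanSpace ℝ (Fin 2)) 1) : EuclideanSpace ℝ (Fin 2))))
        (mfderiv 𝓘(ℝ, EuclideanSpace ℝ (Fin 3)) 𝓘(ℝ, EuclideanSpace ℝ (Fin 4)) (fun p : EuclideanSpace ℝ (Fin 3) =>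
          ((((h j).boundaryTube.toHomeo (circlePt (Complex.arg (toC (L p)) / (2 * Real.pi)),
            ‖L p‖ • ((circlePt (p 2) : sphere (0 : EuclideanSpace ℝ (Fin 2)) 1) : EuclideanSpace ℝ (Fin 2)))).1).1 :
              EuclideanSpace ℝ (Fin 4))) p u) := by
  have h0 : L p ≠ 0 := ne_zero_of_toC_mem_slitPlane hslit
  have hr0 : 0 < ‖L p‖ := norm_pos_iff.2 h0
  have hcc : ((((h j).boundaryTube.toHomeo (circlePt (Complex.arg (toC (L p)) / (2 * Real.pi)),
      ‖L p‖ • ((circlePt (p 2) : sphere (0 : EuclideanSpace ℝ (Fin 2)) 1) : EuclideanSpace ℝ (Fin 2)))).1 :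
        Base g)) ∈ coresComplement h :=
    tubePt_mem_coresComplement D j _ _ hr0 hp
  have hη := ((contMDiffAt_tubeMap (h := h) j p hslit hp).mdifferentiableAt (by simp)).hasMFDerivAt
  have hsB : MDifferentiableAt (𝓡 3) (𝓡∂ 4) (seamB D bX Ψ) ((h j).boundaryTube.toHomeo
      (circlePt (Complex.arg (toC (L p)) / (2 * Real.pi)),
        ‖L p‖ • ((circlePt (p 2) : sphere (0 : EuclideanSpace ℝ (Fin 2)) 1) : EuclideanSpace ℝ (Fin 2)))) :=
    (contMDiffAt_seamB D bX Ψ hcc).mdifferentiableAt (by simp)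
  have hG : MDifferentiableAt (𝓡 3) (𝓡∂ 4) (E ∘ seamB D bX Ψ) ((h j).boundaryTube.toHomeo
      (circlePt (Complex.arg (toC (L p)) / (2 * Real.pi)),
        ‖L p‖ • ((circlePt (p 2) : sphere (0 : EuclideanSpace ℝ (Fin 2)) 1) : EuclideanSpace ℝ (Fin 2)))) :=
    (hE.mdifferentiableAt (by simp)).comp _ hsB
  have hvalG := hasMFDerivAt_val_comp hG
  have hc0 := hvalG.comp p hη
  have hΓ := hc0.congr_of_eventuallyEq (beltChart₃_eventuallyEq_glued D bX Ψ E j p h0 hp)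
  rw [hΓ.mfderiv, mfderiv_tubeChart (g := g) j p hslit hp u, bdDeriv_ambient hG]
  rfl

end Factor

/-- **Sub-goal `helper_beltChart_gluedFactor` of stub `stub_T3_dualPresentation`** (T3 ▸ node `Hgap` ▸ part B
`helper_Hgap_twisting` ▸ transfer step (R6b), the glued factorisation; wave 7, lead c5, worker H1): over the
glued region the columns of the three-dimensional belt-tube chart factor through X3's boundary ambient
differential of `E ∘ seamB` and the tube-side map `η̂ (p) = f♭ (circlePt (arg (toC (L p)) / 2π), ‖L p‖ • circlePt (p 2))`:
`dΓ̂_p (u) = bdDeriv (E ∘ seamB) (η̂ p) (dη♯_p (u))`. [cite: Kosinski1993, VI §6] -/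
theorem helper_beltChart_gluedFactor : ∀ (g : ℕ) (ι : Type) [Finite ι] (h : ι → Literature.Topology.FourManifolds.HandleAttachingMap 3 2 (Literature.Topology.FourManifolds.LefschetzBase.Base g)) (X : Type) [TopologicalSpace X] [ChartedSpace (EuclideanHalfSpace 4) X] [IsManifold (𝓡∂ 4) ∞ X] (D : Literature.Topology.FourManifolds.HandleAttachingMap.MultiAttachmentData h (𝓡∂ 4) X) (bX : Literature.Topology.FourManifolds.BoundaryData (𝓡∂ 4) X (𝓡 3)) [Nonempty bX.carrier] (Ψ : bX.carrier ≃ₘ⟮𝓡 3, 𝓡 3⟯ (Literature.Topology.FourManifolds.LefschetzBase.bBase g).carrier) (E : Literature.Topology.FourManifolds.LefschetzBase.Base g → Literature.Topology.FourManifolds.LefschetzBase.Base g) (j : ι) (L : EuclideanSpace ℝ (Fin 3) →L[ℝ] EuclideanSpace ℝ (Fin 2)), ContMDiff (𝓡∂ 4) (𝓡∂ 4) ∞ E → ∀ (p : EuclideanSpace ℝ (Fin 3)), Literature.Topology.FourManifolds.toC (L p) ∈ Complex.slitPlane → ‖L p‖ < 1 → ∀ (u : EuclideanSpace ℝ (Fin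 3)), mfderiv 𝓘(ℝ, EuclideanSpace ℝ (Fin 3)) 𝓘(ℝ, EuclideanSpace ℝ (Fin 4)) (fun p : EuclideanSpace ℝ (Fin 3) => (E ((Literature.Topology.FourManifolds.BoundaryManifold.boundaryData 3 (Literature.Topology.FourManifolds.LefschetzBase.Base g)).incl (Summit.SmoothPoincare4.SmoothPoincare4.Theorems.AcyclicBisectionExists.ModpBraidOrbits.seamDiffeo bX (Literature.Topology.FourManifolds.LefschetzBase.bBase g) Ψ ((Summit.SmoothPoincare4.SmoothPoincare4.Theorems.AcyclicBisectionExists.ModpBraidOrbits.beltMap D j).boundaryTube.toHomeo (Literature.Topology.FourManifolds.circlePt (p 2), L p))))).1) p u = Summit.SmoothPoincare4.SmoothPoincare4.Theorems.AcyclicBisectionExists.ModpBraidOrbits.bdDeriv g (E ∘ Summit.SmoothPoincare4.SmoothPoincare4.Theorems.AcyclicBisectionExists.ModpBraidOrbits.seamB D bX Ψ) ((h j).boundaryTube.toHomeo (Literature.Topology.FourManifolds.circlePt (Complex.arg (Literature.Topology.FourManifolds.toC (L p)) / (2 * Real.pi)), ‖L p‖ • ((Literature.Topology.FourManifolds.circlePt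 (p 2) : Metric.sphere (0 : EuclideanSpace ℝ (Fin 2)) 1) : EuclideanSpace ℝ (Fin 2)))) (mfderiv 𝓘(ℝ, EuclideanSpace ℝ (Fin 3)) 𝓘(ℝ, EuclideanSpace ℝ (Fin 4)) (fun p : EuclideanSpace ℝ (Fin 3) => ((((h j).boundaryTube.toHomeo (Literature.Topology.FourManifolds.circlePt (Complex.arg (Literature.Topology.FourManifolds.toC (L p)) / (2 * Real.pi)), ‖L p‖ • ((Literature.Topology.FourManifolds.circlePt (p 2) : Metric.sphere (0 : EuclideanSpace ℝ (Fin 2)) 1) : EuclideanSpace ℝ (Fin 2)))).1).1 : EuclideanSpace ℝ (Fin 4))) p u) :=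
  fun _ _ _ _ _ _ _ _ D bX _ Ψ E j _ hE p hslit hp u => mfderiv_beltChart₃_glued D bX Ψ E j hE p hslit hp u

end Summit.SmoothPoincare4.SmoothPoincare4.Theorems.AcyclicBisectionExists.ModpBraidOrbits

end
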